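import Literature.GroupTheory.SpecificGroups.SymplecticTwoUnipotentClassesNotByRank   -- ★ p846842 (this seat): `U(id, J_alt) = SL₂`, `u(1) ≁ u(ε)`
import HarnessLib

/-!
# Rank does NOT classify the nilpotent `Ad Sp₂(K)`-orbits in `sp₂(K) = sl₂(K)`: `N(1)` and `N(ε)` are conjugate iff `ε` is a square
# (Lie twin of ★ p846842; the (V)-INT finite layer at the SECOND tame-ramified vertex — a NEGATIVE lemma)

Topic `Literature/GroupTheory/SpecificGroups`; namespace `Literature.GroupTheory.SpecificGroups`.  THEOREMS ONLY (no definition, no named fact, no instance, no notation,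
no `sorry`).  Cell `pub/hodgecm-mathlib` (crux H413 = `stmt-HodgeConjecture-24833`), «S3-ram» seeding wave (LEAD T11-41; owner p06 (g15); seat F0P3-p03 (g14)); companion
of ★ p846826 (`O₃`: rank classifies unipotent classes AND nilpotent orbits) and ★ p846842 (`Sp₂`: rank does not classify unipotent classes).  For the (V)-INT organ
(level-2 interior strata = nilpotent residual orbits, ★ p846617 inert) at the `ϖ`-modular ramified vertex the relevant finite statement is the LIE-ALGEBRA one: in
`sp(J_alt) = {N : J⁻¹NᵀJ = −N} = sl₂` the rank-`1` nilpotents `N(t) = !![0, t; 0, 0]` satisfy **`g N(t) g⁻¹ = N(t′)` with `g ∈ Sp₂ = SL₂` only if `t′ = a²t`**, so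
`N(1)` and `N(ε)` (`ε` a non-square — exists in `𝔽_q`, `q` odd) are two orbits of the same rank: rank-strata constancy of an `Ad K`-invariant level-2 piece FAILS at that
vertex unless the piece is similitude-invariant.  Elementary `2 × 2` algebra over any field.
HONEST LABEL: HC_CM is proved only modulo the printed citations (the 2 remaining named inputs hLiu418, h413) until rung 0 closes; nothing printed is asserted.

* `formAdjoint_lineNilpotent` (`J_alt⁻¹ N(t)ᵀ J_alt = −N(t)`: `N(t) ∈ sp₂`), `lineNilpotent_sq`, `rank_lineNilpotent`;
* **`exists_sq_mul_eq_of_conj_lineNilpotent`** — `det g = 1`, `g N(t) = N(t′) g`, `t′ ≠ 0` ⇒ `∃ a, t′ = a² t`;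
* **`not_exists_conj_lineNilpotent_of_not_isSquare`**, **`exists_nilpotent_rank_eq_not_conj_of_ringChar_ne_two`**.

## References
* [Wilson2009] R. A. Wilson, *The Finite Simple Groups*, GTM 251 (2009): §3.3.1 p. 46, §3.5.
* [CollingwoodMcGovern1993] D. Collingwood, W. McGovern, *Nilpotent Orbits in Semisimple Lie Algebras* (1993): §9.3 (rational nilpotent orbits of `sl₂`: classes of `t` mod squares).
-/

set_option autoImplicit false

open Matrix Literature.NumberTheory.Automorphic

namespace Literature.GroupTheory.SpecificGroups

variable {K : Type*} [Field K]

/-- `N(t) = !![0, t; 0, 0]` lies in `sp(J_alt)`: `J⁻¹ N(t)ᵀ J = −N(t)` for `J = !![0, 1; -1, 0]` (the tree's form-adjoint convention, `σ = id`). [cite: Wilson2009, §3.5 p. 55] -/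
theorem formAdjoint_lineNilpotent (t : K) :
    (!![(0 : K), 1; -1, 0])⁻¹ * ((!![0, t; 0, 0] : Matrix (Fin 2) (Fin 2) K).map (RingHom.id K))ᵀ * !![(0 : K), 1; -1, 0] = -!![0, t; 0, 0] := by
  have hinv : (!![(0 : K), 1; -1, 0])⁻¹ = !![(0 : K), -1; 1, 0] := by
    refine Matrix.inv_eq_left_inv ?_
    ext i j; fin_cases i <;> fin_cases j <;> simp [Matrix.mul_apply, Fin.sum_univ_two]
  have hT : ((!![0, t; 0, 0] : Matrix (Fin 2) (Fin 2) K).map (RingHom.id K))ᵀ = !![0, 0; t, 0] := by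
    ext i j; fin_cases i <;> fin_cases j <;> rfl
  rw [hinv, hT]
  ext i j; fin_cases i <;> fin_cases j <;> simp [Matrix.mul_apply, Fin.sum_univ_two]

/-- `N(t)² = 0` (the rank-`1` nilpotents of `sl₂` are square-zero). [cite: CollingwoodMcGovern1993, §9.3] -/
theorem lineNilpotent_sq (t : K) : (!![0, t; 0, 0] : Matrix (Fin 2) (Fin 2) K) * !![0, t; 0, 0] = 0 := by
  ext i j; fin_cases i <;> fin_cases j <;> simp [Matrix.mul_apply, Fin.sum_univ_two]

/-- `rank N(t) = 1` for `t ≠ 0`. [cite: Wilson2009, §3.3.1 p. 46] -/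
theorem rank_lineNilpotent {t : K} (ht : t ≠ 0) : (!![0, t; 0, 0] : Matrix (Fin 2) (Fin 2) K).rank = 1 := by
  have h : (!![0, t; 0, 0] : Matrix (Fin 2) (Fin 2) K) = !![1, t; 0, 1] - 1 := by
    ext i j; fin_cases i <;> fin_cases j <;> simp
  rw [h]
  exact rank_lineUnipotent_sub_one ht

/-- **Conjugate line nilpotents differ by a SQUARE**: `det g = 1`, `g·N(t) = N(t′)·g`, `t′ ≠ 0` ⇒ `t′ = a²·t` (namely `g = !![a, b; 0, a⁻¹]`).
[cite: CollingwoodMcGovern1993, §9.3] [cite: Wilson2009, §3.3.1 p. 46] -/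
theorem exists_sq_mul_eq_of_conj_lineNilpotent {g : Matrix (Fin 2) (Fin 2) K} (hg : g.det = 1) {t t' : K} (ht' : t' ≠ 0)
    (h : g * !![0, t; 0, 0] = !![0, t'; 0, 0] * g) : ∃ a : K, t' = a ^ 2 * t := by
  have h00 := congrFun (congrFun h 0) 0
  have h01 := congrFun (congrFun h 0) 1
  simp [Matrix.mul_apply, Fin.sum_univ_two] at h00 h01
  -- `h00 : 0 = t' * g 1 0` ⇒ `c = 0`; `h01 : g 0 0 * t = t' * g 1 1`; `det = a d = 1`
  have hc : g 1 0 = 0 := by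
    rcases h00 with h | h
    · exact absurd h ht'
    · exact h
  rw [Matrix.det_fin_two, hc, mul_zero, sub_zero] at hg
  refine ⟨g 0 0, ?_⟩
  calc t' = t' * (g 0 0 * g 1 1) := by rw [hg, mul_one]
    _ = g 0 0 * (t' * g 1 1) := by ring
    _ = g 0 0 * (g 0 0 * t) := by rw [← h01]
    _ = g 0 0 ^ 2 * t := by ring

/-- **`N(1)` and `N(ε)` are NOT `Ad Sp₂(K)`-conjugate when `ε` is not a square** — although both are rank-`1`, square-zero and skew.
[cite: CollingwoodMcGovern1993, §9.3] -/
theorem not_exists_conj_lineNilpotent_of_not_isSquare {ε : K} (hε : ¬ IsSquare ε) :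
    ¬ ∃ g : GL (Fin 2) K, g ∈ unitaryGroupOfForm (RingHom.id K) !![(0 : K), 1; -1, 0] ∧
      (g : Matrix (Fin 2) (Fin 2) K) * !![0, 1; 0, 0] * ((g⁻¹ : GL (Fin 2) K) : Matrix (Fin 2) (Fin 2) K) = !![0, ε; 0, 0] := by
  rintro ⟨g, hg, hconj⟩
  have hε0 : ε ≠ 0 := fun h0 => hε ⟨0, by rw [h0, mul_zero]⟩
  have hdet := (mem_unitaryGroupOfForm_id_altTwo_iff_det_eq_one g).1 hg
  have hmat : (g : Matrix (Fin 2) (Fin 2) K) * !![0, 1; 0, 0] = !![0, ε; 0, 0] * (g : Matrix (Fin 2) (Fin 2) K) := by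
    have h := congrArg (fun M : Matrix (Fin 2) (Fin 2) K => M * (g : Matrix (Fin 2) (Fin 2) K)) hconj
    simp only [Matrix.mul_assoc] at h
    rw [← Units.val_mul, inv_mul_cancel, Units.val_one, Matrix.mul_one] at h
    exact h
  obtain ⟨a, ha⟩ := exists_sq_mul_eq_of_conj_lineNilpotent hdet hε0 hmat
  exact hε ⟨a, by rw [ha, mul_one, sq]⟩

/-- **Over a finite field of odd characteristic, rank does NOT classify the nilpotent `Ad`-orbits of `U(id, J_alt) = Sp₂ = SL₂` in `sp₂ = sl₂`**: two skew (`J⁻¹NᵀJ = −N`),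
square-zero, rank-`1` matrices that are not conjugate under `U(id, J_alt)` (`N(1)`, `N(ε)`, `ε` a non-square) — contrast ★ p846826 (6) for `so₃`.
[cite: CollingwoodMcGovern1993, §9.3] [cite: Wilson2009, §3.3.1 p. 46] -/
theorem exists_nilpotent_rank_eq_not_conj_of_ringChar_ne_two [Fintype K] (hK : ringChar K ≠ 2) :
    ∃ N N' : Matrix (Fin 2) (Fin 2) K,
      (!![(0 : K), 1; -1, 0])⁻¹ * (N.map (RingHom.id K))ᵀ * !![(0 : K), 1; -1, 0] = -N ∧
      (!![(0 : K), 1; -1, 0])⁻¹ * (N'.map (RingHom.id K))ᵀ * !![(0 : K), 1; -1, 0] = -N' ∧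
      N * N = 0 ∧ N' * N' = 0 ∧ N.rank = 1 ∧ N'.rank = 1 ∧
      ¬ ∃ g : GL (Fin 2) K, g ∈ unitaryGroupOfForm (RingHom.id K) !![(0 : K), 1; -1, 0] ∧
        (g : Matrix (Fin 2) (Fin 2) K) * N * ((g⁻¹ : GL (Fin 2) K) : Matrix (Fin 2) (Fin 2) K) = N' := by
  obtain ⟨ε, hε⟩ := FiniteField.exists_nonsquare hK
  have hε0 : ε ≠ 0 := fun h0 => hε ⟨0, by rw [h0, mul_zero]⟩
  exact ⟨!![0, 1; 0, 0], !![0, ε; 0, 0], formAdjoint_lineNilpotent 1, formAdjoint_lineNilpotent ε, lineNilpotent_sq 1, lineNilpotent_sq ε,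
    rank_lineNilpotent one_ne_zero, rank_lineNilpotent hε0, not_exists_conj_lineNilpotent_of_not_isSquare hε⟩

end Literature.GroupTheory.SpecificGroups
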